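import Literature.Probability.Percolation.KSTPeriodicCorridorStep
import HarnessLib

/-!
# KST-type RSW for periodic measures: the cascading step (Lemma 4)

Topic `Literature/Probability/Percolation`. Proof of [KohlerSchindlerTassion2023, Lemma 4 and
Comment 1] in the constant, positive-scale form `CascadeStepPos k t` of
`KSTPeriodicStatements.lean`, from the corridor lemma `CorridorB`, for `1 ≤ k` and `t ≤ k` (the
offsets `t = 0, 1` of the primal and dual applications): the inclusions
`quasi_subset_quasi_or_noSubpath` (`KSTPeriodicNoSubpath.lean`) and
`noSubpath_inter_quasi_subset` (`KSTPeriodicCorridorStep.lean`), the two-event square-root trick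
twice, positive association and the `kℤ²`-invariance of the translated bridges.

## References

* [KohlerSchindlerTassion2023] L. Köhler-Schindler, V. Tassion, *Crossing probabilities for
  planar percolation*, Duke Math. J. 172 (2023), §4.4, Lemma 4; Comment 1.
-/

namespace Literature.Probability.Percolation

open LatticeModels SimpleGraph _root_.MeasureTheory

noncomputable section

namespace KSTPeriodic

/-! ### The cascading inequality -/

/-- **Lemma 4 of [KohlerSchindlerTassion2023] (cascading), weak periodic form at positive
scales**, from the corridor lemma `CorridorB`, for `1 ≤ k` and `t ≤ k`:
`max {q(m, j), (1 - (1 - b(l))²)/q(l, j)} ≥ 1 - √(1 - q(m, l))`, in the disjunctive form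
`CascadeStepPos k t`. Proof: `𝓠(m, l) ⊆ 𝓠(m, j) ∪ 𝓔` and the two-event square-root trick give
`max {q(m, j), μ(𝓔)} ≥ θ`; positive association gives `μ(𝓔) q(l, j) ≤ μ(𝓔 ∩ 𝓠(l, j))`, and
`𝓔 ∩ 𝓠(l, j)` lies in the union of two `kℤ²`-translates of `𝓑(l)`, whose probability is at most
`1 - (1 - b(l))²` (square-root trick again, translation invariance).
[cite: KohlerSchindlerTassion2023, Lemma 4 and Comment 1] -/
theorem cascadeStepPos_of_corridorB {k t : ℕ} (hk : 1 ≤ k) (htk : t ≤ k) (hCo : CorridorB) :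
    CascadeStepPos k t := by
  intro μ _ hμ hL m l j hj hjl hlm h12j h12l _h12m
  classical
  obtain ⟨c, hl⟩ := h12l
  have hw' : l / 12 ≤ m / 4 + k := by omega
  -- the events
  set Qml : Set (BondConfig (Site 2)) := quasi t (m / 4 + k) m (l / 12) l with hQml
  set Qmj : Set (BondConfig (Site 2)) := quasi t (m / 4 + k) m (j / 12) j with hQmj
  set Qlj : Set (BondConfig (Site 2)) := quasi t (l / 4 + k) l (j / 12) j with hQlj
  set E : Set (BondConfig (Site 2)) := {ω | ∃ (p q : Site 2) (P : (zdGraph 2).Walk p q),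
      (p ∈ upperTarget t (l / 12) l ∧ q ∈ upperTarget t (l / 12) (-(l : ℤ) - t) ∧
        (∀ x ∈ P.support, x ∈ mRegion t (l / 12) l) ∧
        ¬ ∃ (p' q' : Site 2) (κ : (zdGraph 2).Walk p' q'),
          p' ∈ upperTarget t (j / 12) j ∧ q' ∈ upperTarget t (j / 12) (-(j : ℤ) - t) ∧
          (∀ x ∈ κ.support, x ∈ mRegion t (j / 12) j) ∧ ∀ e ∈ κ.edges, e ∈ P.edges) ∧
      ∀ e ∈ P.edges, e ∈ ω} with hEdef
  set BL : Set (BondConfig (Site 2)) :=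
    openCrossing (Site.shift ((k : ℤ) • ![-(2 * (c : ℤ) + 1), 0]) '' mRegion t (l / 12) l)
      (Site.shift ((k : ℤ) • ![-(2 * (c : ℤ) + 1), 0]) '' leftPart t (l / 12) l)
      (Site.shift ((k : ℤ) • ![-(2 * (c : ℤ) + 1), 0]) '' rightPart t (l / 12) l) with hBL
  set BR : Set (BondConfig (Site 2)) :=
    openCrossing (Site.shift ((k : ℤ) • ![2 * (c : ℤ) + 1, 0]) '' mRegion t (l / 12) l)
      (Site.shift ((k : ℤ) • ![2 * (c : ℤ) + 1, 0]) '' leftPart t (l / 12) l)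
      (Site.shift ((k : ℤ) • ![2 * (c : ℤ) + 1, 0]) '' rightPart t (l / 12) l) with hBR
  have hEm : MeasurableSet E := measurableSet_exists_openWalk _
  have hEu : IsUpperSet E := isUpperSet_exists_openWalk _
  have hQmj_m : MeasurableSet Qmj := measurableSet_quasi _ _ _ _ _
  have hQmj_u : IsUpperSet Qmj := isUpperSet_quasi _ _ _ _ _
  have hQlj_m : MeasurableSet Qlj := measurableSet_quasi _ _ _ _ _
  have hQlj_u : IsUpperSet Qlj := isUpperSet_quasi _ _ _ _ _
  have hBL_m : MeasurableSet BL := measurableSet_openCrossing_of_countable _ _ _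
  have hBR_m : MeasurableSet BR := measurableSet_openCrossing_of_countable _ _ _
  have hBL_u : IsUpperSet BL := isUpperSet_openCrossing _ _ _
  have hBR_u : IsUpperSet BR := isUpperSet_openCrossing _ _ _
  -- the two inclusions, almost surely
  have hinc1 : ∀ᵐ ω ∂μ, ω ∈ Qml → ω ∈ Qmj ∪ E := by
    filter_upwards [hL] with ω hω hQ
    rcases quasi_subset_quasi_or_noSubpath hω hj hlm hw' hQ with h | h
    · exact Or.inl h
    · exact Or.inr h
  have hinc2 : ∀ᵐ ω ∂μ, ω ∈ E ∩ Qlj → ω ∈ BL ∪ BR := by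
    filter_upwards [hL] with ω hω hEQ
    exact noSubpath_inter_quasi_subset hω hk htk hj hjl h12j hl hCo hEQ.1 hEQ.2
  -- the translated bridges have probability `b(l)`
  have hBL_b : μ.real BL = μ.real (bridge t (l / 12) l) :=
    real_openCrossing_image (hμ.shift_inv _) _ _ _
  have hBR_b : μ.real BR = μ.real (bridge t (l / 12) l) :=
    real_openCrossing_image (hμ.shift_inv _) _ _ _
  -- Part 1 and the square-root trick: `θ ≤ max (q(m,j)) (μ E)`
  have h1 : μ.real Qml ≤ μ.real (Qmj ∪ E) := measureReal_mono_of_ae hinc1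
  have h2 := one_sub_mul_one_sub_le hμ hQmj_u hEu hQmj_m hEm
  set q₀ : ℝ := max (μ.real Qmj) (μ.real E) with hq₀
  have hq₀1 : q₀ ≤ 1 := max_le measureReal_le_one measureReal_le_one
  have hsq : (1 - q₀) ^ 2 ≤ 1 - μ.real Qml := by
    have ha : 1 - q₀ ≤ 1 - μ.real Qmj := by linarith [le_max_left (μ.real Qmj) (μ.real E)]
    have hb : 1 - q₀ ≤ 1 - μ.real E := by linarith [le_max_right (μ.real Qmj) (μ.real E)]
    nlinarith [mul_le_mul ha hb (by linarith) (by linarith [@measureReal_le_one _ _ μ _ Qmj])]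
  have hθ : 1 - Real.sqrt (1 - μ.real Qml) ≤ q₀ := by
    have : 1 - q₀ ≤ Real.sqrt (1 - μ.real Qml) := Real.le_sqrt_of_sq_le hsq |>.trans_eq' rfl
    linarith
  rcases le_max_iff.1 hθ with h | h
  · exact Or.inl h
  · right
    -- Part 2: `μ E · q(l,j) ≤ μ(E ∩ 𝓠(l,j)) ≤ μ(BL ∪ BR) ≤ 1 - (1 - b(l))²`
    have h3 : μ.real E * μ.real Qlj ≤ μ.real (E ∩ Qlj) := mul_le_real_inter hμ hEu hQlj_u hEm hQlj_m
    have h4 : μ.real (E ∩ Qlj) ≤ μ.real (BL ∪ BR) := measureReal_mono_of_ae hinc2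
    have h5 := one_sub_mul_one_sub_le hμ hBL_u hBR_u hBL_m hBR_m
    rw [hBL_b, hBR_b] at h5
    have hq : 0 ≤ μ.real Qlj := measureReal_nonneg
    calc (1 - Real.sqrt (1 - μ.real Qml)) * μ.real Qlj ≤ μ.real E * μ.real Qlj :=
          mul_le_mul_of_nonneg_right h hq
      _ ≤ 1 - (1 - μ.real (bridge t (l / 12) l)) ^ 2 := by nlinarith [h3, h4, h5]

end KSTPeriodic

end

end Literature.Probability.Percolation
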